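import Summits.QuantumFields.YangMills.Theorems.BalabanUVNodesK0S5HBRows164CoreCubeSeq
import Literature.MathematicalPhysics.QuantumFieldTheory.Balaban1983to89.Node00.TorusCoverCubeMemberPrint
import Literature.MathematicalPhysics.QuantumFieldTheory.Balaban1983to89.Node00.TorusCoverBoxStencils
import Summits.QuantumFields.YangMills.Theorems.UnitScaleTiltProp7BondAvgIterCoercivity
import HarnessLib

/-!
# K0⁷ `stub_prop8StepCoP13` (stmt-QuantumFields-20541), sub-target S5 — **THE COLLAR NUMERICS OF [Balaban1985Variational] (144)∕(163) AT NODE 00's FOUR-TORI**: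
# «R₁M₁ sufficiently big» as a threshold on the collar `ρ` compatible with the big blocks, the big-block divisibility of the level torus from the height binder, and the
# non-wrapping of the collared print cube from ONE torus-size floor — the «numerics» binders of the S6 `HB`-summand theorem BY SHAPE, at the print datum `propCubeP`

Cell `pub-ymgap`, width seat `pub-ymgap-k0-s1-w3` gen 4 (D-0149; START LIST v10 §k0-s1; bus STARTED + CLAIM-1 2026-08-28 INBOX l.28832).  `--kind proof --supports
stmt-QuantumFields-20541 --as helper`; count-neutral; def-free.

WHY.  The S6 consumer's `N07LocalLettersHBAtCubeDomains.letters10On_HB_cubeDomains_box` (dag-n07-w4, p604811) — [Balaban1985Variational] (164) ⇒ the `HB` letters of (165)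
on the grid cube of a print datum, at the torus family `Node00.cubeDomains` — displays, besides the DATA (160)∕(155) and the kernel formula, six NUMERICS∕GEOMETRY binders:
`F.L·M_h ∣ ρ`, `F.L·M_h ∣ a_i`, `F.L·M_h ∣ M`, `F.L·M_h ∣ sitesPerDir (K − n)`, `R·(F.L·M_h) ≤ ρ`, `Set.InjOn π (cube L a M ρ (K − n) 0)`, and the (163)-row
`8C_d·C·B₃·e^{−δ₁ρ} ≤ θ` (print p. 303: *«We may assume that R₁M₁ is sufficiently big, so that B₃e^{−½δ₀R₁M₁} ≦ ½»*).  Referee ref-G READ289 on 39b carried the same two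
items to the consumer side (NOTE-1 `M₁ ∣ sitesPerDir k`, NOTE-2 `InjOn (cover P) □₀`).  THIS FILE discharges them by arithmetic, AT PRINT'S DATUM `propCubeP` of a grid cube
(n07-e 36a: corner on the `ρ`-grid, side `M′ = sideP` a multiple of `ρ`, collar `ρ` exactly): given ONLY `F.L·M_h ∣ ρ`, the height `a′ + 1 ≤ F.m + n` (`M_h = L^{a′}`;
the consumer's `a′ + 3 ≤ F.m + n` implies it) and the torus-size floor `M + 11d + 6ρ ≤ sitesPerDir (K − n) = 2L^{m+n}` («the collared print cube `□₀`, of side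
`(M′ + 4ρ)·L^{K−n} ≤ (M + 11d + 6ρ)·L^{K−n}` fine sites, is narrower than the fine period»), ALL the divisibilities and the non-wrapping hold; and «R₁M₁ big» is a
THRESHOLD: for `A ≥ 0`, `θ > 0`, `δ₁ > 0` and any `R`, `M₁ ≥ 1`, `L₀` there is `ρ⋆` such that EVERY `ρ ≥ ρ⋆` has `A·e^{−δ₁ρ} ≤ θ ∧ R·M₁ ≤ ρ ∧ L₀ ≤ ρ`, with a
multiple of `M₁` as an explicit witness (P12's `exists_collar_threshold`, by name).

WHAT IS PROVED (sorry-free; axioms standard; no definition; integer∕real arithmetic and lattice bookkeeping only).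
§1 `pow_dvd_sitesPerDir_of_le` (`e + j ≤ m + K ⇒ L^e ∣ sitesPerDir j`) · ★ `mul_dvd_sitesPerDir_T4` (`M_h = L^{a′}`, `n ≤ K`, `a′ + 1 ≤ F.m + n ⇒ F.L·M_h ∣
   (F.P K).sitesPerDir (K − n)`); the period identity `sitesPerDir 0 = L^k · sitesPerDir k` is ym3-torus's `Prop7FlatCoercivity.sitesPerDir_zero_eq_pow_mul`, BY NAME.
§2 «R₁M₁ big»: ★ `exists_collar_floor` (threshold form) · ★ `exists_collar_multiple` (a multiple of `M₁` above the threshold) · `exists_rho_h163` (the consumer's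
   letters `A := 8C_dCB₃`) · `le_pow_self_L` (`M_h⁰ ≤ L^{M_h⁰}`: the size binder `M_h⁰ ≤ M_h = L^{a′}` is inhabited at `a′ := M_h⁰`).
§3 non-wrapping: ★★ `injOn_cover_cube_zero` (ANY `a M ρ k`: `(M + 4ρ)·L^k ≤ sitesPerDir 0 ⇒ Set.InjOn (cover P) (cube L a M ρ k 0)` — the width of `□₀` is
   `L^k·M + 2ρ·gs L k ≤ (M + 4ρ)·L^k` by `B8Eq131Cubes.margin_own`, then n07-w4's `Sect2.eq_of_cover_eq_of_inBox`) · `injOn_cover_cube_zero_of_le_sitesPerDir` (level form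
   `M + 4ρ ≤ sitesPerDir k`) · ★★ `injOn_cover_cube_propCubeP` (at the print datum: `M + 11d + 6ρ ≤ sitesPerDir n` suffices, by 36a's `sideP_le`).
§4 ★★★ `numerics_propCubeP (F : T4Family)` — at `c := propCubeP (F.P K) (K − n) hn M ρ hρ idx`: from `F.L·M_h ∣ ρ`, `a′ + 1 ≤ F.m + n`, `M + 11d + 6ρ ≤
   (F.P K).sitesPerDir (K − n)`: `F.L·M_h ∣ c.a i`, `F.L·M_h ∣ c.M`, `F.L·M_h ∣ c.ρ`, `F.L·M_h ∣ sitesPerDir (K − n)`, `Set.InjOn (cover (F.P K)) (cube L c.a c.M c.ρ (K − n) 0)`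
   — the five binders of `letters10On_HB_cubeDomains_box` at `a := c.a`, `M := c.M`, `ρ := c.ρ`, BY SHAPE (the consumer composes by name; nothing of its file restated).
HONEST SCOPE: arithmetic; the data (160)∕(155), the kernel formula of `H_V`, the choice of the grid cube (`M`, `idx`) and of `ρ` against the record's layer width `ν.M₁`
(member floor `11d + 4ρ ≤ ν.M₁`, 36a) remain the consumer's ∕ the K0 witness's; nothing of [Balaban1985Variational]∕[Balaban1985RegularSpaces]∕[Balaban1984PropagatorsII]
asserted or discharged; stub 1 ∕ K0⁷ NOT closed; N07 NOT discharged (5∕27 unmoved); one finite 𝕋⁴ programme at fixed ε — R4 closes the conditional finite-𝕋⁴ rung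
`BalabanLadder.UV` only; the YM mass gap (Clay) is NOT proved by any of this; nothing continuum ∕ ℝ⁴ ∕ OS.  No `def`, no `instance`, no `notation`, no `sorry`.

References: T. Bałaban, CMP **102** (1985) 277–309 [Balaban1985Variational] (144) p.300, (163) p.303; CMP **99** (1985) 75–102 [Balaban1985RegularSpaces] p.98 (the cubes
`□_j`, «M is a multiple of R₁M₁»); CMP **96** (1984) 223–250 [Balaban1984PropagatorsII] (2.1) p.224; CMP **109** (1987) 249–301 [Balaban1987RG1] (0.1) p.251 (the torus
`2L^{m+K−j}` sites per direction).
-/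

set_option autoImplicit false

noncomputable section

namespace Summit.QuantumFields.YangMills.Theorems.K0S5CollarNumerics

open Literature.MathematicalPhysics.QuantumFieldTheory.Balaban1983to89
open Literature.MathematicalPhysics.QuantumFieldTheory.Balaban1983to89.Node00
open B15Eq112TorusCover (cover)
open B14DomainGeom (Pt)
open B7Prop1Local (InBox)
open B8Ineq130 (tlo thi tlo_apply thi_apply)
open B8Eq131Cubes (cube sqLo sqHi bLo bHi gs margin_own)
open T4Continuum (T4Family)
open Summit.QuantumFields.YangMills.Theorems.K0S5HBRows164CoreCubeSeq (exists_collar_threshold)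
open Summit.QuantumFields.YangMills.Theorems.Prop7FlatCoercivity (sitesPerDir_zero_eq_pow_mul)

/-! ## §1  Big-block divisibility of the level torus from the height binder -/

section Divisibility

variable {P : Params}

/-- `L^e ∣ sitesPerDir j = 2L^{m+K−j}` whenever `e + j ≤ m + K`. [cite: Balaban1987RG1, (0.1) p.251; Balaban1984PropagatorsII, (2.1) p.224 («big blocks of the lattice»)] -/
theorem pow_dvd_sitesPerDir_of_le {e j : ℕ} (h : e + j ≤ P.m + P.K) : P.L ^ e ∣ P.sitesPerDir j := by
  unfold Params.sitesPerDir
  exact Dvd.dvd.mul_left (pow_dvd_pow P.L (by omega)) 2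

/-- ★ **THE BIG BLOCK `L·M_h = L^{a′+1}` TILES THE LEVEL-`(K − n)` TORUS OF NODE 00's FAMILY** (`2L^{m+n}` sites per direction) as soon as `a′ + 1 ≤ F.m + n` (`n ≤ K`)
— the binder `F.L·M_h ∣ (F.P K).sitesPerDir (K − n)` of the S6 `HB` theorem (ref-G READ289 NOTE-1), implied by its own size binder `a′ + 3 ≤ F.m + n`.
[cite: Balaban1984PropagatorsII, (2.1) p.224; Balaban1987RG1, (0.1) p.251] -/
theorem mul_dvd_sitesPerDir_T4 (F : T4Family) {n K a' Mh : ℕ} (hMh : Mh = F.L ^ a') (hn : n ≤ K) (ha : a' + 1 ≤ F.m + n) :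
    F.L * Mh ∣ (F.P K).sitesPerDir (K - n) := by
  rw [hMh, ← pow_succ']
  refine pow_dvd_sitesPerDir_of_le (P := F.P K) ?_
  simp only [T4Family.P_m, T4Family.P_K]
  omega

end Divisibility

/-! ## §2  «R₁M₁ sufficiently big» ((163)) as a threshold on the collar, compatible with the big blocks -/

section Threshold

/-- ★ **«R₁M₁ SUFFICIENTLY BIG», THRESHOLD FORM**: for `A ≥ 0`, `θ > 0`, `δ₁ > 0` and any `R`, `M₁`, `L₀` there is `ρ⋆` such that EVERY collar `ρ ≥ ρ⋆` satisfies the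
(163)-row `A·e^{−δ₁ρ} ≤ θ` together with `R·M₁ ≤ ρ` and `L₀ ≤ ρ` (P12's `exists_collar_threshold`, by name, joined with two `max`es).
[cite: Balaban1985Variational, (163) p.303 («We may assume that R₁M₁ is sufficiently big, so that B₃e^{−½δ₀R₁M₁} ≦ ½»)] -/
theorem exists_collar_floor {A θ δ₁ : ℝ} (hA : 0 ≤ A) (hθ : 0 < θ) (hδ₁ : 0 < δ₁) (R M₁ L₀ : ℕ) :
    ∃ ρ₁ : ℕ, ∀ ρ : ℕ, ρ₁ ≤ ρ → A * Real.exp (-(δ₁ * (ρ : ℝ))) ≤ θ ∧ R * M₁ ≤ ρ ∧ L₀ ≤ ρ := by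
  obtain ⟨R₁, hR₁⟩ := exists_collar_threshold hA hθ hδ₁
  refine ⟨max R₁ (max (R * M₁) L₀), fun ρ hρ => ⟨hR₁ ρ ?_, ?_, ?_⟩⟩
  · exact_mod_cast (le_max_left _ _).trans hρ
  · exact ((le_max_left _ _).trans (le_max_right _ _)).trans hρ
  · exact ((le_max_right _ _).trans (le_max_right _ _)).trans hρ

/-- ★ **A BIG COLLAR ON THE BIG-BLOCK GRID**: with `M₁ ≥ 1` there is a collar `ρ` that is a MULTIPLE of `M₁` with `R·M₁ ≤ ρ`, `L₀ ≤ ρ` and `A·e^{−δ₁ρ} ≤ θ` — print's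
`ρ = R₁M₁` with «R₁M₁ sufficiently big» and «□_j a sum of big blocks» at once. [cite: Balaban1985Variational, (163) p.303; Balaban1985RegularSpaces, p.98 («M is a multiple of R₁M₁»)] -/
theorem exists_collar_multiple {A θ δ₁ : ℝ} (hA : 0 ≤ A) (hθ : 0 < θ) (hδ₁ : 0 < δ₁) {M₁ : ℕ} (hM₁ : 1 ≤ M₁) (R L₀ : ℕ) :
    ∃ ρ : ℕ, M₁ ∣ ρ ∧ R * M₁ ≤ ρ ∧ L₀ ≤ ρ ∧ A * Real.exp (-(δ₁ * (ρ : ℝ))) ≤ θ := by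
  obtain ⟨ρ₁, h⟩ := exists_collar_floor hA hθ hδ₁ R M₁ L₀
  obtain ⟨h1, h2, h3⟩ := h (M₁ * ρ₁) (Nat.le_mul_of_pos_left ρ₁ hM₁)
  exact ⟨M₁ * ρ₁, Dvd.intro ρ₁ rfl, h2, h3, h1⟩

/-- **THE (163)-ROW OF THE `HB` THEOREM IN ITS OWN LETTERS**: for `C_d, C, B₃ ≥ 0`, `θ > 0`, `δ₁ > 0`, `M₁ ≥ 1` there is a multiple `ρ` of `M₁` with `R·M₁ ≤ ρ`,
`L₀ ≤ ρ` and `8·C_d·C·B₃·e^{−δ₁ρ} ≤ θ`. [cite: Balaban1985Variational, (163) p.303] -/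
theorem exists_rho_h163 {Cd C B₃ θ δ₁ : ℝ} (hCd : 0 ≤ Cd) (hC : 0 ≤ C) (hB₃ : 0 ≤ B₃) (hθ : 0 < θ) (hδ₁ : 0 < δ₁) {M₁ : ℕ} (hM₁ : 1 ≤ M₁)
    (R L₀ : ℕ) :
    ∃ ρ : ℕ, M₁ ∣ ρ ∧ R * M₁ ≤ ρ ∧ L₀ ≤ ρ ∧ 8 * Cd * C * B₃ * Real.exp (-(δ₁ * (ρ : ℝ))) ≤ θ :=
  exists_collar_multiple (by positivity) hθ hδ₁ hM₁ R L₀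

/-- The size binder `M_h⁰ ≤ M_h = L^{a′}` is inhabited at `a′ := M_h⁰`: `M_h⁰ ≤ L^{M_h⁰}` (`L ≥ 1`; here `L > 11`). [folklore] -/
theorem le_pow_self_L (F : T4Family) (Mh₀ : ℕ) : Mh₀ ≤ F.L ^ Mh₀ :=
  (Nat.lt_pow_self (by have := F.hL11; omega)).le

end Threshold

/-! ## §3  Non-wrapping of the collared cube `□₀` from one torus-size floor -/

section NonWrapping

variable {P : Params}

/-- ★★ **`□₀` DOES NOT WRAP WHEN IT IS NARROWER THAN THE FINE PERIOD**: for ANY corner `a`, side `M`, collar `ρ` and depth `k`, the collared cube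
`□₀ = cube L a M ρ k 0 = [L^k a − ρ·gs L k, L^k(a + M) − 1 + ρ·gs L k]ᵈ` has width `L^k·M + 2ρ·gs L k ≤ (M + 4ρ)·L^k` (`gs L k ≤ 2L^k`, `B8Eq131Cubes.margin_own`); so
`(M + 4ρ)·L^k ≤ sitesPerDir 0` makes the cover `π` injective on it (n07-w4's `Sect2.eq_of_cover_eq_of_inBox`) — the binder `Set.InjOn (cover P) (cube L a M ρ k 0)` of the S6
`HB` theorem ∕ of 39b's window lemmas (ref-G READ289 NOTE-2). [cite: Balaban1985RegularSpaces, p.98 («□₀ ⊃ □₁ ⊃ … ⊃ □_k ⊃ □», «Σ R₁M₁Lʲη < (1 − L⁻¹)⁻¹R₁M₁ ≤ 2R₁M₁»); Balaban1987RG1, (0.1) p.251] -/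
theorem injOn_cover_cube_zero {a : Pt P.d} {M ρ k : ℕ} (hw : (M + 4 * ρ) * P.L ^ k ≤ P.sitesPerDir 0) :
    Set.InjOn (cover P) (cube P.L a M ρ k 0) := by
  have hL2 : 2 ≤ P.L := P.hL.2
  have hwid : ∀ i, thi P.L (sqHi P.L a M ρ k 0) 0 i - tlo P.L (sqLo P.L a ρ k 0) 0 i + 1 ≤ P.sitesPerDir 0 := by
    intro i
    rw [thi_apply, tlo_apply]
    simp only [sqHi, sqLo, bHi, bLo, Nat.sub_zero, pow_zero, one_mul]
    have hm : ((ρ * gs P.L k : ℕ) : ℤ) ≤ ((P.L ^ k * (2 * ρ) : ℕ) : ℤ) := by exact_mod_cast margin_own hL2 k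
    have hw' : (((M + 4 * ρ) * P.L ^ k : ℕ) : ℤ) ≤ ((P.sitesPerDir 0 : ℕ) : ℤ) := by exact_mod_cast hw
    push_cast at hm hw' ⊢
    nlinarith [hm, hw']
  intro x hx x' hx' h
  exact Sect2.eq_of_cover_eq_of_inBox hwid hx hx' h

/-- **LEVEL FORM OF THE FLOOR**: `M + 4ρ ≤ sitesPerDir k = 2L^{m+K−k}` (`k ≤ m + K`) ⇒ `π` is injective on `cube L a M ρ k 0`. [cite: Balaban1985RegularSpaces, p.98; Balaban1987RG1, (0.1) p.251] -/
theorem injOn_cover_cube_zero_of_le_sitesPerDir {a : Pt P.d} {M ρ k : ℕ} (hk : k ≤ P.m + P.K) (hw : M + 4 * ρ ≤ P.sitesPerDir k) :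
    Set.InjOn (cover P) (cube P.L a M ρ k 0) := by
  refine injOn_cover_cube_zero ?_
  rw [sitesPerDir_zero_eq_pow_mul hk, mul_comm]
  exact Nat.mul_le_mul_left _ hw

/-- ★★ **THE COLLARED PRINT CUBE OF A GRID CUBE DOES NOT WRAP** under the floor `M + 11d + 6ρ ≤ sitesPerDir n` (`n ≤ m + K`): the print datum `propCubeP P n hn M ρ hρ idx`
(36a) has side `M′ = sideP ≤ M + 11d + 2ρ` and collar `ρ`, so `M′ + 4ρ ≤ M + 11d + 6ρ`. [cite: Balaban1985RegularSpaces, p.98; Balaban1985Variational, (144) p.300; Balaban1987RG1, (0.1) p.251] -/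
theorem injOn_cover_cube_propCubeP (n : ℕ) (hn : 1 ≤ n) (hnK : n ≤ P.m + P.K) (M ρ : ℕ) (hρ : P.L ≤ ρ) (idx : Pt P.d)
    (hw : M + 11 * P.d + 6 * ρ ≤ P.sitesPerDir n) :
    Set.InjOn (cover P) (cube P.L (propCubeP P n hn M ρ hρ idx).a (propCubeP P n hn M ρ hρ idx).M (propCubeP P n hn M ρ hρ idx).ρ
      (propCubeP P n hn M ρ hρ idx).k 0) := by
  have h1 := sideP_le (P := P) M ρ
  simp only [propCubeP_a, propCubeP_M, propCubeP_ρ, propCubeP_k]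
  refine injOn_cover_cube_zero_of_le_sitesPerDir hnK ?_
  omega

end NonWrapping

/-! ## §4  The numerics binders of the S6 `HB` theorem at the print datum of NODE 00's family -/

section AtRecord

/-- ★★★ **THE FIVE NUMERICS∕GEOMETRY BINDERS OF `letters10On_HB_cubeDomains_box` AT THE PRINT DATUM, FROM THREE ARITHMETIC FACTS**: for NODE 00's family `F`, level
`K − n ≥ 1`, big block `F.L·M_h`, `M_h = L^{a′}` with `a′ + 1 ≤ F.m + n`, a collar `ρ ≥ L` with `F.L·M_h ∣ ρ` (§2 supplies such `ρ` with (163) and `R·(F.L·M_h) ≤ ρ`),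
any grid-cube size `M` and index `idx`, and the torus-size floor `M + 11d + 6ρ ≤ (F.P K).sitesPerDir (K − n)`: at `c := propCubeP (F.P K) (K − n) hn M ρ hρ idx` —
`F.L·M_h ∣ c.a i`, `F.L·M_h ∣ c.M`, `F.L·M_h ∣ c.ρ`, `F.L·M_h ∣ (F.P K).sitesPerDir (K − n)`, and `Set.InjOn (cover (F.P K)) (cube L c.a c.M c.ρ (K − n) 0)`
(36a `isPrint_propCubeP … .of_dvd`, §1, §3 by name). [cite: Balaban1985Variational, (144) p.300, (163) p.303; Balaban1985RegularSpaces, p.98; Balaban1984PropagatorsII, (2.1) p.224] -/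
theorem numerics_propCubeP (F : T4Family) {n K : ℕ} (hn1 : 1 ≤ K - n) (hk : K - n ≤ (F.P K).m + (F.P K).K)
    {Mh a' : ℕ} (hMh : Mh = F.L ^ a') (ha : a' + 1 ≤ F.m + n)
    {M ρ : ℕ} (hρ : (F.P K).L ≤ ρ) (hdvd : F.L * Mh ∣ ρ) (idx : Pt (F.P K).d)
    (hw : M + 11 * (F.P K).d + 6 * ρ ≤ (F.P K).sitesPerDir (K - n)) :
    (∀ i, ((F.L * Mh : ℕ) : ℤ) ∣ (propCubeP (F.P K) (K - n) hn1 M ρ hρ idx).a i) ∧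
    F.L * Mh ∣ (propCubeP (F.P K) (K - n) hn1 M ρ hρ idx).M ∧
    F.L * Mh ∣ (propCubeP (F.P K) (K - n) hn1 M ρ hρ idx).ρ ∧
    F.L * Mh ∣ (F.P K).sitesPerDir (K - n) ∧
    Set.InjOn (cover (F.P K)) (cube (F.P K).L (propCubeP (F.P K) (K - n) hn1 M ρ hρ idx).a (propCubeP (F.P K) (K - n) hn1 M ρ hρ idx).M
      (propCubeP (F.P K) (K - n) hn1 M ρ hρ idx).ρ (K - n) 0) := by
  have hP := (isPrint_propCubeP (F.P K) (K - n) hn1 M ρ hρ idx).of_dvd hdvd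
  refine ⟨hP.corner_dvd, hP.side_dvd, hP.rho_dvd, mul_dvd_sitesPerDir_T4 F hMh (by omega) ha, ?_⟩
  exact injOn_cover_cube_propCubeP (P := F.P K) (K - n) hn1 hk M ρ hρ idx hw

end AtRecord

end Summit.QuantumFields.YangMills.Theorems.K0S5CollarNumerics

end
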